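import Literature.MathematicalPhysics.KineticTheory.HardSphereDisplacementPathLength
import Literature.MathematicalPhysics.KineticTheory.CollisionTubePullbackFlight
import Literature.Analysis.FluidPDE.HardSphereWindowEnumeration
import Literature.Analysis.FluidPDE.HardSphereCollisionRecordMeasurable
import Literature.Analysis.FluidPDE.LoadedCollisionRecordMeasurable
import Literature.Analysis.FluidPDE.HardSpherePhaseSpaceProofs
import HarnessLib

/-!
# Jump payloads along the collisions of one hard sphere telescope (Abel summation over flights)

Topic `Literature/MathematicalPhysics/KineticTheory`, over the hard-sphere flow prelude on the flat
torus (`HardSphereFlow (Torus.geometry d) ε N`, `HardSphereCollisionRecord`,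
`HardSphereCollisionEnumeration`, `HardSphereWindowEnumeration`, `HardSphereDisplacementPathLength`).

Along a good orbit consider one particle `i`, a window `(0, h]` and the first `J` collision times
`t_0 < t_1 < ⋯ < t_{J-1}` of `i` in it.  At each of them `i` receives the **jump payload**
`φ(xᵢ(t_n)) · (g(vᵢ(t_n)) - g(vᵢ(t_n⁻)))` of a bounded velocity observable `g` (`|g| ≤ b`) weighted
by a bounded `D`-Lipschitz position observable `φ` (`|φ| ≤ 1`), the pre-collisional velocity
`vᵢ(t_n⁻)` being read off the post-collisional configuration through the elastic involution and the
partner (`HardSphereCollisionRecord.ofConfig … i (partner … i)`, as kinetic-theory collision sums do).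
Since the velocity of `i` is constant on each of its free flights — ACROSS the collisions of the
other particles — `vᵢ(t_n⁻) = vᵢ(t_{n-1})` (`vᵢ(t_0⁻) = vᵢ(0)`), so the payloads telescope by Abel
summation into two boundary terms and a sum of increments of `φ(xᵢ)` over consecutive collisions,
the latter controlled by the Lipschitz constant times the path length:

* `HardSphereFlow.vel_flow_eq_of_forall_not_participates`,
  `HardSphereFlow.leftLim_vel_eq_of_forall_not_participates` — a particle taking part in no
  collision during `(a, b]` (resp. `(a, b)`) keeps its velocity on `[a, b]` (resp. has left-limit
  velocity `vᵢ(a)` at `b`) (any dimension `d`; from the general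
  `apply_eq_translate_of_forall_not_participates` of `CollisionTubePullbackFlight`);
* `HardSphereFlow.preVel_partner_eq_vel` — at a collision of `i` preceded by a flight free on
  `(a, t)`, the recorded pre-collisional velocity of `i` is `vᵢ(a)` (`ε < 1/2`: regular geometry);
  `HardSphereFlow.preVel_partner_nthCollisionTimeOf_zero / _succ` — along the enumeration;
* `sum_range_succ_mul_sub_eq` — Abel summation `∑_{n<m+1} uₙ(w_{n+1} - wₙ) = u_m w_{m+1} - u₀ w₀ -
  ∑_{n<m} (u_{n+1} - uₙ) w_{n+1}`;
* `HardSphereFlow.abs_sum_range_jumpPayload_le` — **the telescoping bound**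
  `|∑_{n<J} φ(xᵢ(t_n)) (g(vᵢ(t_n)) - g(vᵢ(t_n⁻)))| ≤ 2b + bD ∫₀ʰ ‖vᵢ(s)‖ ds` for every `J` not
  exceeding the number of collisions of `i` in `(0, h]` (minimal-image displacement ≤ path length,
  `HardSphereFlow.euclidDist_flow_le_integral_norm_vel`; the sup metric of `UnitAddTorus d` is below
  the minimal-image distance, `Torus.norm_sub_le_euclidDist_holds`);
* `measurable_preVel_partner` — the recorded pre-collisional velocity through the partner is a
  measurable function of the configuration (any geometry with measurable separation map).

This is the deterministic part of the observation that the collision jump process of `ψ₀(vᵢ)` tested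
against a smooth `φ(xᵢ)` is a free term in hydrodynamic-limit window estimates (Kipnis–Landim 1999
App. 1 §5–6: Dynkin martingales of jump functionals; GST 2013 §4.1 for the trajectory facts).
No new definitions.

## References

* I. Gallagher, L. Saint-Raymond, B. Texier, *From Newton to Boltzmann* (2013), §4.1, Def. 4.1.2,
  Prop. 4.1.1.
* C. Kipnis, C. Landim, *Scaling Limits of Interacting Particle Systems* (1999), App. 1 §5–6.
-/

noncomputable section

namespace Literature.MathematicalPhysics.KineticTheory

open _root_.MeasureTheory Set Filter Function
open scoped _root_.Topology BigOperators
open Literature.Analysis.FluidPDE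

/-! ### Abel summation -/

/-- **Abel summation by parts** for real sequences:
`∑_{n<m+1} uₙ (w_{n+1} - wₙ) = u_m w_{m+1} - u₀ w₀ - ∑_{n<m} (u_{n+1} - uₙ) w_{n+1}`. [folklore] -/
theorem sum_range_succ_mul_sub_eq (u w : ℕ → ℝ) (m : ℕ) :
    ∑ n ∈ Finset.range (m + 1), u n * (w (n + 1) - w n) =
      u m * w (m + 1) - u 0 * w 0 - ∑ n ∈ Finset.range m, (u (n + 1) - u n) * w (n + 1) := by
  induction m with
  | zero => simp; ring
  | succ m ih =>
    rw [Finset.sum_range_succ, ih, Finset.sum_range_succ]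
    ring

/-- **Bound from Abel summation**: if `|uₙ| ≤ 1` and `|wₙ| ≤ b` then
`|∑_{n<J} uₙ (w_{n+1} - wₙ)| ≤ 2b + b ∑_{n+1<J} |u_{n+1} - uₙ|`. [folklore] -/
theorem abs_sum_range_mul_sub_le {u w : ℕ → ℝ} {b : ℝ} (hu : ∀ n, |u n| ≤ 1) (hw : ∀ n, |w n| ≤ b)
    (J : ℕ) :
    |∑ n ∈ Finset.range J, u n * (w (n + 1) - w n)| ≤
      2 * b + b * ∑ n ∈ Finset.range (J - 1), |u (n + 1) - u n| := by
  have hb : 0 ≤ b := (abs_nonneg _).trans (hw 0)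
  cases J with
  | zero =>
    simp only [Finset.range_zero, Finset.sum_empty, abs_zero]
    positivity
  | succ m =>
    rw [sum_range_succ_mul_sub_eq, Nat.add_sub_cancel]
    have h1 : |u m * w (m + 1)| ≤ b := by
      rw [abs_mul]
      exact (mul_le_mul (hu m) (hw (m + 1)) (abs_nonneg _) zero_le_one).trans_eq (one_mul b)
    have h2 : |u 0 * w 0| ≤ b := by
      rw [abs_mul]
      exact (mul_le_mul (hu 0) (hw 0) (abs_nonneg _) zero_le_one).trans_eq (one_mul b)
    have h3 : |∑ n ∈ Finset.range m, (u (n + 1) - u n) * w (n + 1)| ≤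
        b * ∑ n ∈ Finset.range m, |u (n + 1) - u n| := by
      refine (Finset.abs_sum_le_sum_abs _ _).trans ?_
      rw [Finset.mul_sum]
      refine Finset.sum_le_sum fun n _ => ?_
      rw [abs_mul, mul_comm b]
      exact mul_le_mul_of_nonneg_left (hw (n + 1)) (abs_nonneg _)
    calc |u m * w (m + 1) - u 0 * w 0 - ∑ n ∈ Finset.range m, (u (n + 1) - u n) * w (n + 1)|
        ≤ |u m * w (m + 1)| + |u 0 * w 0| +
            |∑ n ∈ Finset.range m, (u (n + 1) - u n) * w (n + 1)| := by
          exact (abs_sub _ _).trans (add_le_add (abs_sub _ _) le_rfl)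
      _ ≤ b + b + b * ∑ n ∈ Finset.range m, |u (n + 1) - u n| := add_le_add (add_le_add h1 h2) h3
      _ = _ := by ring

/-! ### The recorded pre-collisional velocity through the partner is measurable -/

section Measurable

variable {d : Type*} [Fintype d] {X : Type*} [MeasurableSpace X] {N : ℕ} {G : Geometry d X}

/-- **The pre-collisional velocity of `i` read off a configuration through its partner is a
measurable function of the configuration** (measurable separation map: `ℝ^d`, `𝕋^d`): each
`ζ ↦ (ofConfig G ε ζ t i j).preVel.1` is measurable (`HardSphereCollisionRecord.measurable_ofConfig`)
and the partner is a measurable `Fin N`-valued selection (`measurable_partner`). [folklore] -/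
theorem measurable_preVel_partner (hG : Measurable fun p : X × X => G.sepVec p.1 p.2) (ε t : ℝ)
    (i : Fin N) :
    Measurable fun ζ : Config N d X =>
      (HardSphereCollisionRecord.ofConfig G ε ζ t i (partner G ε ζ i)).preVel.1 := by
  have hF : ∀ j : Fin N, Measurable fun ζ : Config N d X =>
      (HardSphereCollisionRecord.ofConfig G ε ζ t i j).preVel.1 := fun j =>
    (HardSphereCollisionRecord.measurable_preVel.comp
      (HardSphereCollisionRecord.measurable_ofConfig hG ε t i j)).fst
  have h2 : Measurable fun q : Config N d X × Fin N =>
      (HardSphereCollisionRecord.ofConfig G ε q.1 t i q.2).preVel.1 :=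
    measurable_from_prod_countable_left (f := fun q : Config N d X × Fin N =>
      (HardSphereCollisionRecord.ofConfig G ε q.1 t i q.2).preVel.1) hF
  exact h2.comp (measurable_id.prodMk (measurable_partner hG i))

end Measurable

/-! ### Velocities of one particle along a good orbit on the torus -/

section Flow

variable {d : Type*} [Fintype d] {ε : ℝ} {N : ℕ}

/-- **A particle that takes part in no collision during `(a, b]` keeps its velocity**:
`vₖ(b) = vₖ(a)` along a good orbit of a hard-sphere flow on `𝕋^d`.  Dot-notation extension of
`Literature.Analysis.FluidPDE.HardSphereFlow`. [cite: GST2013, §4.1] -/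
theorem _root_.Literature.Analysis.FluidPDE.HardSphereFlow.vel_flow_eq_of_forall_not_participates
    (Φ : HardSphereFlow (Torus.geometry d) ε N) {z : Config N d (UnitAddTorus d)} (hz : z ∈ Φ.good)
    (k : Fin N) {a b : ℝ} (hab : a ≤ b)
    (hk : ∀ u ∈ Ioc a b, ¬ Participates (Torus.geometry d) ε (Φ.flow u z) k) :
    (Φ.flow b z k).2 = (Φ.flow a z k).2 := by
  have h := apply_eq_translate_of_forall_not_participates (Φ.isTrajectory z hz)
    Torus.continuous_geometry_translate k hab hk
  rw [h]

/-- **The left-limit velocity at `b` of a particle with no collision in `(a, b)`** is its velocity at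
`a` (`a < b`).  Dot-notation extension of `Literature.Analysis.FluidPDE.HardSphereFlow`.
[cite: GST2013, §4.1] -/
theorem _root_.Literature.Analysis.FluidPDE.HardSphereFlow.leftLim_vel_eq_of_forall_not_participates
    (Φ : HardSphereFlow (Torus.geometry d) ε N) {z : Config N d (UnitAddTorus d)} (hz : z ∈ Φ.good)
    (k : Fin N) {a b : ℝ} (hab : a < b)
    (hk : ∀ u ∈ Ioo a b, ¬ Participates (Torus.geometry d) ε (Φ.flow u z) k) :
    (leftLim (fun t => Φ.flow t z) b k).2 = (Φ.flow a z k).2 := by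
  have hev : Continuous fun ζ : Config N d (UnitAddTorus d) => (ζ k).2 := (continuous_apply k).snd
  have h1 : Tendsto (fun u => (Φ.flow u z k).2) (𝓝[<] b) (𝓝 (leftLim (fun t => Φ.flow t z) b k).2) :=
    (hev.tendsto _).comp ((Φ.isTrajectory z hz).tendsto_leftLim Torus.continuous_geometry_translate b)
  have h2 : Tendsto (fun u => (Φ.flow u z k).2) (𝓝[<] b) (𝓝 (Φ.flow a z k).2) := by
    refine tendsto_const_nhds.congr' ?_
    filter_upwards [Ioo_mem_nhdsLT hab] with u hu
    exact (Φ.vel_flow_eq_of_forall_not_participates hz k hu.1.le fun s hs =>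
      hk s ⟨hs.1, lt_of_le_of_lt hs.2 hu.2⟩).symm
  exact tendsto_nhds_unique h1 h2

/-- **Pre-collisional velocities are flight velocities.**  At a collision of `i` at time `t`
preceded by a flight of `i` free on `(a, t)` (`a < t`), the pre-collisional velocity of `i` recorded
through the elastic involution and the partner equals `vᵢ(a)` (`ε < 1/2`, so that the torus geometry
is regular and the contact pair can be oriented `(i, partner)`; the time label `t₀` of the record is
irrelevant).  Dot-notation extension of `Literature.Analysis.FluidPDE.HardSphereFlow`. [folklore] -/
theorem _root_.Literature.Analysis.FluidPDE.HardSphereFlow.preVel_partner_eq_vel (hε : ε < 2⁻¹)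
    (Φ : HardSphereFlow (Torus.geometry d) ε N) {z : Config N d (UnitAddTorus d)} (hz : z ∈ Φ.good)
    (i : Fin N) {a t : ℝ} (hat : a < t)
    (hfree : ∀ u ∈ Ioo a t, ¬ Participates (Torus.geometry d) ε (Φ.flow u z) i)
    (hpart : Participates (Torus.geometry d) ε (Φ.flow t z) i) (t₀ : ℝ) :
    (HardSphereCollisionRecord.ofConfig (Torus.geometry d) ε (Φ.flow t z) t₀ i
        (partner (Torus.geometry d) ε (Φ.flow t z) i)).preVel.1 = (Φ.flow a z i).2 := by
  have hG := Torus.isHardSphereRegular_geometry (d := d) hε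
  set p := partner (Torus.geometry d) ε (Φ.flow t z) i with hp
  have hip : (i, p) ∈ contactPairs (Torus.geometry d) ε (Φ.flow t z) := by
    rcases collide_partner hpart with h | h
    · exact h
    · exact (swap_mem_contactPairs_iff hG (p := (i, p))).1 h
  have h := (Φ.isTrajectory z hz).ofConfig_preVel_eq_leftLim (t := t) hip
  rw [HardSphereCollisionRecord.ofConfig_preVel] at h ⊢
  rw [h]
  exact Φ.leftLim_vel_eq_of_forall_not_participates hz i hat hfree

/-- Along the enumeration, first collision: on the good set, if particle `i` has a collision in
`(0, h]`, its recorded pre-collisional velocity at its first collision time is its initial velocity.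
[folklore] -/
theorem _root_.Literature.Analysis.FluidPDE.HardSphereFlow.preVel_partner_nthCollisionTimeOf_zero
    (hε : ε < 2⁻¹) (Φ : HardSphereFlow (Torus.geometry d) ε N) {z : Config N d (UnitAddTorus d)}
    (hz : z ∈ Φ.good) (i : Fin N) {h : ℝ}
    (hJ : 0 < (collisionTimesOf (Torus.geometry d) ε (fun s => Φ.flow s z) i ∩ Ioc 0 h).ncard)
    (t₀ : ℝ) :
    (HardSphereCollisionRecord.ofConfig (Torus.geometry d) ε (Φ.flow (Φ.nthCollisionTimeOf i 0 z) z) t₀ i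
        (partner (Torus.geometry d) ε (Φ.flow (Φ.nthCollisionTimeOf i 0 z) z) i)).preVel.1 = (z i).2 := by
  have hmem := Φ.nthCollisionTimeOf_mem_window hz i hJ
  have h := Φ.preVel_partner_eq_vel hε hz i hmem.2.1
    (fun u hu => (Φ.isTrajectory z hz).not_participates_of_mem_Ioo_nthCollisionTimeOf_zero hu)
    hmem.1 t₀
  rwa [Φ.flow_zero z hz] at h

/-- Along the enumeration, later collisions: on the good set, at its `(n+1)`-st collision time in
the window the recorded pre-collisional velocity of `i` is its (post-collisional) velocity at its
`n`-th collision time. [folklore] -/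
theorem _root_.Literature.Analysis.FluidPDE.HardSphereFlow.preVel_partner_nthCollisionTimeOf_succ
    (hε : ε < 2⁻¹) (Φ : HardSphereFlow (Torus.geometry d) ε N) {z : Config N d (UnitAddTorus d)}
    (hz : z ∈ Φ.good) (i : Fin N) {h : ℝ} {n : ℕ}
    (hn : n + 1 < (collisionTimesOf (Torus.geometry d) ε (fun s => Φ.flow s z) i ∩ Ioc 0 h).ncard)
    (t₀ : ℝ) :
    (HardSphereCollisionRecord.ofConfig (Torus.geometry d) ε
        (Φ.flow (Φ.nthCollisionTimeOf i (n + 1) z) z) t₀ i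
        (partner (Torus.geometry d) ε (Φ.flow (Φ.nthCollisionTimeOf i (n + 1) z) z) i)).preVel.1 =
      (Φ.flow (Φ.nthCollisionTimeOf i n z) z i).2 := by
  have hmem := Φ.nthCollisionTimeOf_mem_window hz i hn
  have hlt : Φ.nthCollisionTimeOf i n z < Φ.nthCollisionTimeOf i (n + 1) z :=
    Φ.strictMonoOn_nthCollisionTimeOf_window hz i h (show n < _ from n.lt_succ_self.trans hn) hn
      n.lt_succ_self
  exact Φ.preVel_partner_eq_vel hε hz i hlt
    (fun u hu => Φ.not_participates_of_mem_Ioo_nthCollisionTimeOf_succ hz hu) hmem.1 t₀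

/-- **The telescoping bound for jump payloads.**  On the good set of a hard-sphere flow on `𝕋^d`
(`ε < 1/2`), for a particle `i`, a window `(0, h]` (`h ≥ 0`), `J` not exceeding the number of
collisions of `i` in the window, a position weight `φ` with `|φ| ≤ 1` and `|φ x - φ y| ≤ D dist x y`
(`D ≥ 0`, sup metric of `UnitAddTorus d`), and a velocity observable `g` with `|g| ≤ b`:
`|∑_{n<J} φ(xᵢ(t_n)) · (g(vᵢ(t_n)) - g(vᵢ(t_n⁻)))| ≤ 2b + bD ∫₀ʰ ‖vᵢ(s)‖ ds`,
`vᵢ(t_n⁻)` the pre-collisional velocity recorded through the partner.  Proof: `vᵢ(t_n⁻) = vᵢ(t_{n-1})`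
(`vᵢ(t_0⁻) = vᵢ(0)`), Abel summation, `|φ(xᵢ(t_{n+1})) - φ(xᵢ(t_n))| ≤ D ∫_{t_n}^{t_{n+1}} ‖vᵢ‖`
(displacement ≤ path length), adjacent intervals.  Dot-notation extension of
`Literature.Analysis.FluidPDE.HardSphereFlow`. [folklore] -/
theorem _root_.Literature.Analysis.FluidPDE.HardSphereFlow.abs_sum_range_jumpPayload_le
    (hε : ε < 2⁻¹) (Φ : HardSphereFlow (Torus.geometry d) ε N) {z : Config N d (UnitAddTorus d)}
    (hz : z ∈ Φ.good) (i : Fin N) {h : ℝ} (hh : 0 ≤ h) {J : ℕ}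
    (hJ : J ≤ (collisionTimesOf (Torus.geometry d) ε (fun s => Φ.flow s z) i ∩ Ioc 0 h).ncard)
    {φ : UnitAddTorus d → ℝ} {D : ℝ} (hD : 0 ≤ D) (hφ1 : ∀ x, |φ x| ≤ 1)
    (hφD : ∀ x y, |φ x - φ y| ≤ D * dist x y) {g : EuclideanSpace ℝ d → ℝ} {b : ℝ}
    (hg : ∀ v, |g v| ≤ b) (t₀ : ℝ) :
    |∑ n ∈ Finset.range J, φ (Φ.flow (Φ.nthCollisionTimeOf i n z) z i).1 *
        (g (Φ.flow (Φ.nthCollisionTimeOf i n z) z i).2 -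
          g (HardSphereCollisionRecord.ofConfig (Torus.geometry d) ε
              (Φ.flow (Φ.nthCollisionTimeOf i n z) z) t₀ i
              (partner (Torus.geometry d) ε (Φ.flow (Φ.nthCollisionTimeOf i n z) z) i)).preVel.1)| ≤
      2 * b + b * D * ∫ s in (0 : ℝ)..h, ‖(Φ.flow s z i).2‖ := by
  have hb : 0 ≤ b := (abs_nonneg _).trans (hg 0)
  set T : ℕ → ℝ := fun n => Φ.nthCollisionTimeOf i n z with hT
  have hmem : ∀ n < J, T n ∈ collisionTimesOf (Torus.geometry d) ε (fun s => Φ.flow s z) i ∩ Ioc 0 h :=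
    fun n hn => Φ.nthCollisionTimeOf_mem_window hz i (lt_of_lt_of_le hn hJ)
  have hmono : StrictMonoOn T (Iio J) :=
    (Φ.strictMonoOn_nthCollisionTimeOf_window hz i h).mono fun n hn => lt_of_lt_of_le hn hJ
  -- the flight velocities
  set u : ℕ → ℝ := fun n => φ (Φ.flow (T n) z i).1 with hu
  set w : ℕ → ℝ := fun n => Nat.casesOn n (g (z i).2) fun m => g (Φ.flow (T m) z i).2 with hw
  have hw0 : w 0 = g (z i).2 := rfl
  have hwS : ∀ m, w (m + 1) = g (Φ.flow (T m) z i).2 := fun m => rfl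
  have hpre : ∀ n < J, g (HardSphereCollisionRecord.ofConfig (Torus.geometry d) ε
      (Φ.flow (T n) z) t₀ i (partner (Torus.geometry d) ε (Φ.flow (T n) z) i)).preVel.1 = w n := by
    intro n hn
    cases n with
    | zero => rw [hw0, Φ.preVel_partner_nthCollisionTimeOf_zero hε hz i (lt_of_lt_of_le hn hJ) t₀]
    | succ m => rw [hwS, Φ.preVel_partner_nthCollisionTimeOf_succ hε hz i (lt_of_lt_of_le hn hJ) t₀]
  have hsum : ∑ n ∈ Finset.range J, φ (Φ.flow (T n) z i).1 *
      (g (Φ.flow (T n) z i).2 - g (HardSphereCollisionRecord.ofConfig (Torus.geometry d) ε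
        (Φ.flow (T n) z) t₀ i (partner (Torus.geometry d) ε (Φ.flow (T n) z) i)).preVel.1) =
      ∑ n ∈ Finset.range J, u n * (w (n + 1) - w n) := by
    refine Finset.sum_congr rfl fun n hn => ?_
    rw [hpre n (Finset.mem_range.1 hn), hwS]
  rw [hsum]
  refine (abs_sum_range_mul_sub_le (b := b) (fun n => hφ1 _) (fun n => ?_) J).trans ?_
  · cases n with
    | zero => rw [hw0]; exact hg _
    | succ m => rw [hwS]; exact hg _
  -- the increments of `φ(xᵢ)` are controlled by the path length
  have hinc : ∑ n ∈ Finset.range (J - 1), |u (n + 1) - u n| ≤ D * ∫ s in (0 : ℝ)..h, ‖(Φ.flow s z i).2‖ := by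
    cases J with
    | zero => simpa using mul_nonneg hD (Φ.integral_norm_vel_flow_nonneg z i hh)
    | succ m =>
      rw [Nat.add_sub_cancel]
      have hstep : ∀ n < m, |u (n + 1) - u n| ≤ D * ∫ s in T n..T (n + 1), ‖(Φ.flow s z i).2‖ := by
        intro n hn
        have hn1 : n + 1 < m + 1 := Nat.succ_lt_succ hn
        have hle : T n ≤ T (n + 1) :=
          (hmono (show n < m + 1 from hn.trans m.lt_succ_self) hn1 n.lt_succ_self).le
        refine (hφD _ _).trans (mul_le_mul_of_nonneg_left ?_ hD)
        rw [dist_eq_norm]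
        exact (Torus.norm_sub_le_euclidDist_holds _ _).trans
          (Φ.euclidDist_flow_le_integral_norm_vel hz i hle)
      calc ∑ n ∈ Finset.range m, |u (n + 1) - u n|
          ≤ ∑ n ∈ Finset.range m, D * ∫ s in T n..T (n + 1), ‖(Φ.flow s z i).2‖ :=
            Finset.sum_le_sum fun n hn => hstep n (Finset.mem_range.1 hn)
        _ = D * ∫ s in T 0..T m, ‖(Φ.flow s z i).2‖ := by
            rw [← Finset.mul_sum, intervalIntegral.sum_integral_adjacent_intervals]
            exact fun k _ => Φ.intervalIntegrable_norm_vel_flow hz i _ _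
        _ ≤ D * ∫ s in (0 : ℝ)..h, ‖(Φ.flow s z i).2‖ := by
            refine mul_le_mul_of_nonneg_left ?_ hD
            have h0 : 0 ≤ T 0 := (hmem 0 m.succ_pos).2.1.le
            have hm : T m ≤ h := (hmem m m.lt_succ_self).2.2
            have h0m : T 0 ≤ T m := hmono.monotoneOn m.succ_pos m.lt_succ_self (Nat.zero_le m)
            exact Φ.integral_norm_vel_flow_mono hz i h0 h0m hm
  calc 2 * b + b * ∑ n ∈ Finset.range (J - 1), |u (n + 1) - u n|
      ≤ 2 * b + b * (D * ∫ s in (0 : ℝ)..h, ‖(Φ.flow s z i).2‖) :=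
        add_le_add le_rfl (mul_le_mul_of_nonneg_left hinc hb)
    _ = 2 * b + b * D * ∫ s in (0 : ℝ)..h, ‖(Φ.flow s z i).2‖ := by ring

end Flow

end Literature.MathematicalPhysics.KineticTheory

end
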